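import Summits.CriticalPhenomena.CardyFormulaZ2.Theses.CardyMagicRigidity
import Summits.CriticalPhenomena.CardyFormulaZ2.Theorems.CardyMagicRigidityLoopLimitZ2EqTConditional
import Summits.CriticalPhenomena.CardyFormulaZ2.Theorems.CardyMagicRigidityMagicFormulaZ2
import Summits.CriticalPhenomena.CardyFormulaZ2.Theorems.CardyMagicRigidityTransferContinuityReduction
import Summits.CriticalPhenomena.CardyFormulaZ2.Theorems.CardyMagicRigidityMagicFormulaTDenseReduction
import Summits.CriticalPhenomena.CardyFormulaZ2.Theorems.CardyMagicRigidityLoopsToCrossings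
import Summits.CriticalPhenomena.CardyFormulaZ2.Theorems.CardyMagicRigiditySmirnovTri
import Summits.CriticalPhenomena.CardyFormulaZ2.Theorems.CardyMagicRigidityAssembly
import Summits.CriticalPhenomena.CardyFormulaZ2.Theorems.CardyMagicRigidityLoopLimitFromMagic
import HarnessLib

/-!
# Route `CardyMagicRigidity` — composition audit of the deciding theorem `closes`
# (unit pitem-compose-CriticalPhenomena-CardyMag-a54e07cf, 2026-08-17)

Sub-problem `CriticalPhenomena/CardyFormulaZ2`, route `route-CriticalPhenomena-CardyMagicRigidity`. The
deciding theorem `Summit.CriticalPhenomena.CardyFormulaZ2.Theses.CardyMagicRigidity.closes` has nine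
hypotheses; four are PROVED in the tree (`LoopsToCrossings_of`, `smirnovTri_proof`,
`cardyMagicRigidity_assembly_proof`, `loopLimitFromMagic_proof`) and five are open
(`LoopLimitZ2EqT`, `MagicFormulaZ2`, `NestingRigidity`, `MagicFormulaT`, `TransferContinuity`).
This sorry-free file composes everything already landed and exhibits the EXACT residual leaf set
under which `closes` fires — the hidden leaves of the route:

* `LoopLimitZ2EqT` (stmt-4833) ⇐ the three registered, unlanded stubs of line `Sketch`
  (`Cruxes/LoopLimitZ2EqT/Lines/Sketch.lean` r7): S4 `TriToSquareLoops`, S5b `InfluenceVanishes`,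
  S7c `CardyToCLE` — through the landed `loopLimitZ2EqT_of_residuals` (p123663);
* `NestingRigidity` (stmt-4835) ⇐ `LoopLimitZ2EqT` by pure logic (it is literally
  `MagicFormulaZ2 → MagicFormulaT → LoopLimitZ2EqT`); its own three lines are dead (G4 routing
  blindness, `not_tame_rigidity` p132831), so it has no leaf set of its own beyond X's;
* `MagicFormulaZ2` (stmt-4834) ⇐ the Literature NAMED FACT
  `Literature.Probability.Percolation.dklm2026_corollary10` (no `_holds` in the tree) through the
  landed `magicFormulaZ2_of_dklm2026`;
* `MagicFormulaT` (stmt-4836) and `TransferContinuity` (stmt-4838) are EQUIVALENT leaves given the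
  two above (`magicFormulaT_of_loopLimitZ2EqT`, `transferContinuity_of_magicFormulas`, both landed):
  one of them must be supplied; in the tree `MagicFormulaT` reduces only to the unlanded registered
  stub `stub_denseMagicT` (`magicFormulaT_of_uniformDenseMagicT`, line `Sketch` dead) and
  `TransferContinuity` only to the three unfiled truncation inputs (Z), (T), (B) of
  `transferContinuity_of_truncation`.

It also records that the sub-problem conjunct itself needs only X: `_root_.CardyFormulaZ2` follows
from `LoopLimitZ2EqT` alone through the proved items (`cardyFormulaZ2_of_loopLimitZ2EqT`), hence from
the three hex-segment residuals alone (`cardyFormulaZ2_of_hexSegmentResiduals`).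
-/

namespace Summit.CriticalPhenomena.CardyFormulaZ2.Theorems

open Summit.CriticalPhenomena.CardyFormulaZ2.Theses.CardyMagicRigidity
open Summit.CriticalPhenomena.CardyFormulaZ2.Cruxes.LoopLimitZ2EqT.HexSegment
  (TriToSquareLoops InfluenceVanishes CardyToCLE loopLimitZ2EqT_of_residuals)
open Summit.CriticalPhenomena.CardyFormulaZ2.Cruxes.LoopsToCrossings.OracleSandwich (LoopsToCrossings_of)
open Summit.CriticalPhenomena.CardyFormulaZ2.Cruxes.MagicFormulaT.LineSketch
  (magicFormulaT_of_uniformDenseMagicT)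

/-! ## §1 What is proved outright (four of the nine hypotheses of `closes`) -/

example : LoopsToCrossings := LoopsToCrossings_of
example : SmirnovTri := smirnovTri_proof
example : Assembly := cardyMagicRigidity_assembly_proof
example : LoopLimitFromMagic := loopLimitFromMagic_proof

/-! ## §2 The best in-tree reductions of the five open hypotheses (all conditional) -/

example : TriToSquareLoops → InfluenceVanishes → CardyToCLE → LoopLimitZ2EqT :=
  loopLimitZ2EqT_of_residuals
example (h : Literature.Probability.Percolation.dklm2026_corollary10) : MagicFormulaZ2 :=
  magicFormulaZ2_of_dklm2026 h
example : LoopLimitZ2EqT → MagicFormulaZ2 → TransferContinuity → MagicFormulaT :=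
  magicFormulaT_of_loopLimitZ2EqT
example : MagicFormulaZ2 → MagicFormulaT → TransferContinuity := transferContinuity_of_magicFormulas
example := @magicFormulaT_of_uniformDenseMagicT

/-- `NestingRigidity` is, as a proposition, `MagicFormulaZ2 → MagicFormulaT → LoopLimitZ2EqT`; it
therefore follows from the target `X = LoopLimitZ2EqT` by pure logic and carries no leaf of its own in
a composition of `closes`. [folklore] -/
theorem nestingRigidity_of_loopLimitZ2EqT' (hX : LoopLimitZ2EqT) : NestingRigidity := fun _ _ ↦ hX

/-! ## §3 The conjunct from `X` alone, through the proved items -/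

/-- **`CardyFormulaZ2` from full-plane loop universality `X = LoopLimitZ2EqT` alone**, through the
PROVED crux `LoopsToCrossings` (`LoopsToCrossings_of`: bond − tri → 0 in every conformal rectangle)
and the PROVED support `SmirnovTri` (`smirnovTri_proof`: tri → F(η)); the same three lines as the
body of `closes`. [folklore] -/
theorem cardyFormulaZ2_of_loopLimitZ2EqT :
    Summit.CriticalPhenomena.CardyFormulaZ2.Theses.CardyMagicRigidity.LoopLimitZ2EqT → _root_.CardyFormulaZ2 := by
  intro hX R φ x hux
  have htri : Filter.Tendsto (Literature.Probability.Percolation.triDomainCrossingProb R)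
      (nhdsWithin 0 (Set.Ioi 0))
      (nhds (Literature.Probability.RandomPlanarGeometry.cardyFunction
        (Literature.Probability.RandomPlanarGeometry.crossRatio x))) := smirnovTri_proof R φ x hux
  have key := (LoopsToCrossings_of hX R).add htri
  simp only [sub_add_cancel, zero_add] at key
  exact key

/-- **The conjunct from the three hex-segment residuals alone**: S4 `TriToSquareLoops` (bond-`ℤ²` ~
bond-`𝕋̃` at loop level, the unpublished isoradial universality [HM24]), S5b `InfluenceVanishes`
(crossing universality along the Chayes–Lei self-dual family) and S7c `CardyToCLE` (Camia–Newman for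
critical bond-`𝕋̃`, relative form) imply `CardyFormulaZ2` — no magic formula, no transfer continuity.
[folklore] -/
theorem cardyFormulaZ2_of_hexSegmentResiduals (hS4 : TriToSquareLoops) (hS5b : InfluenceVanishes)
    (hS7c : CardyToCLE) : _root_.CardyFormulaZ2 :=
  cardyFormulaZ2_of_loopLimitZ2EqT (loopLimitZ2EqT_of_residuals hS4 hS5b hS7c)

/-! ## §4 `closes` fired modulo the hidden leaves -/

/-- **`closes` fires modulo exactly these leaves (variant A, `TransferContinuity` supplied)**: the
three hex-segment residuals S4/S5b/S7c (⇒ `h0`, and `h3` by logic), the named fact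
`dklm2026_corollary10` (⇒ `h2`), and `TransferContinuity` itself (⇒ `h4` through
`magicFormulaT_of_loopLimitZ2EqT`); the other four hypotheses are the proved items. [folklore] -/
theorem closes_of_hiddenLeaves (hS4 : TriToSquareLoops) (hS5b : InfluenceVanishes)
    (hS7c : CardyToCLE) (hDKLM : Literature.Probability.Percolation.dklm2026_corollary10)
    (h9 : TransferContinuity) : _root_.CardyFormulaZ2 :=
  have h0 : LoopLimitZ2EqT := loopLimitZ2EqT_of_residuals hS4 hS5b hS7c
  have h2 : MagicFormulaZ2 := magicFormulaZ2_of_dklm2026 hDKLM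
  closes h0 h2 (nestingRigidity_of_loopLimitZ2EqT' h0) (magicFormulaT_of_loopLimitZ2EqT h0 h2 h9)
    LoopsToCrossings_of h9 smirnovTri_proof cardyMagicRigidity_assembly_proof loopLimitFromMagic_proof

/-- **`closes` fires modulo exactly these leaves (variant B, `MagicFormulaT` supplied)**: S4/S5b/S7c,
`dklm2026_corollary10`, and `MagicFormulaT` itself (⇒ `h9` through
`transferContinuity_of_magicFormulas`). [folklore] -/
theorem closes_of_hiddenLeaves' (hS4 : TriToSquareLoops) (hS5b : InfluenceVanishes)
    (hS7c : CardyToCLE) (hDKLM : Literature.Probability.Percolation.dklm2026_corollary10)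
    (h4 : MagicFormulaT) : _root_.CardyFormulaZ2 :=
  have h0 : LoopLimitZ2EqT := loopLimitZ2EqT_of_residuals hS4 hS5b hS7c
  have h2 : MagicFormulaZ2 := magicFormulaZ2_of_dklm2026 hDKLM
  closes h0 h2 (nestingRigidity_of_loopLimitZ2EqT' h0) h4 LoopsToCrossings_of
    (transferContinuity_of_magicFormulas h2 h4) smirnovTri_proof cardyMagicRigidity_assembly_proof
    loopLimitFromMagic_proof

end Summit.CriticalPhenomena.CardyFormulaZ2.Theorems
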